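import Summits.Ventures.Crystal3D.Theorems.StickyWulffConstantGenericWallFloorStackLedgerLocalTools
import HarnessLib

/-!
# Walk positions live in the REACH SET of their grain (crux `GenericWallFloor`, stmt-Ventures-19480, line `WallLedgerG`)

HONEST FRAMING. Venture `Summits/Ventures/Crystal3D` (cell `crystal3d-full`), helper `--supports` the crux
`GenericWallFloor` of `route-Ventures-StickyWulffConstant`, REGISTERED line `WallLedgerG`, open stub
`stub_twoSlabAdhesion`.  Structure only; F-C1 not moved; NOT the crux.

THE ARRIVAL CASE SPLIT (19480-p1 g7, R41W-ARCH-g7 §5: «an arriving grain-1 walker pins the relative coset» vs «none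
arrives ⇒ the grain pays ½κ»), first brick.  A stack walker of the grain `(A, t)` starts on a ball of the affine lattice
`A·Λ₀ + t` and every successful step — FULL, POP or PUSH — moves it by the slot vector `F w` of the NEW top entry of its
stack (`walkStep_fst_eq_add_top`).  Hence its position never leaves the REACH SET
`reachSet A t M = A·Λ₀ + t + reachGroup M`, `reachGroup M` the additive subgroup of `ℝ³` generated by the slot vectors
of the frames `M` its stacks can carry (`walkRun_fst_mem_reachSet`; `M` = all frames of sound well-formed stacks over the
bottom, or the countable `chainFrames`).  Consumed by `…StackLedgerOffReach`: when the two grains' reach sets are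
DISJOINT (the relative translation `t₂ − t₁` lies off the countable registry set `A₁Λ₀ + A₂Λ₀ + H₁ + H₂`) no walker of
either grain can stand on a ball of the far sample (no arrival) and no ball hosts ends of both grains (no cross
coincidence) — the two one-sided ledgers add up to the full charge `½(κ₁ + κ₂) ≥ 1` with no separation hypothesis at all.
WHAT THIS IS NOT: not the stub; no ledger here; F-C1 not moved.
-/

noncomputable section

namespace Summit.Ventures.Crystal3D.Theorems

open Summit.Ventures.Crystal3D Finset
open Literature.MathematicalPhysics.StatisticalMechanics (fccStacking)
open scoped InnerProductSpace

variable {X : Finset (EuclideanSpace ℝ (Fin 3))}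

/-! ### Reach group and reach set -/

/-- The REACH GROUP of a frame set `M`: the additive subgroup of `ℝ³` generated by the slot vectors `F w`, `F ∈ M`,
`w ∈ fccSlots`. -/
def reachGroup (M : Set (EuclideanSpace ℝ (Fin 3) ≃ₗᵢ[ℝ] EuclideanSpace ℝ (Fin 3))) :
    AddSubgroup (EuclideanSpace ℝ (Fin 3)) :=
  AddSubgroup.closure {v | ∃ F ∈ M, ∃ w ∈ fccSlots, v = F w}

/-- Slot vectors of frames of `M` lie in the reach group. -/
theorem frame_slot_mem_reachGroup {M : Set (EuclideanSpace ℝ (Fin 3) ≃ₗᵢ[ℝ] EuclideanSpace ℝ (Fin 3))}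
    {F : EuclideanSpace ℝ (Fin 3) ≃ₗᵢ[ℝ] EuclideanSpace ℝ (Fin 3)} (hF : F ∈ M) {w : EuclideanSpace ℝ (Fin 3)}
    (hw : w ∈ fccSlots) : F w ∈ reachGroup M :=
  AddSubgroup.subset_closure ⟨F, hF, w, hw, rfl⟩

/-- The reach group is monotone in the frame set. -/
theorem reachGroup_mono {M M' : Set (EuclideanSpace ℝ (Fin 3) ≃ₗᵢ[ℝ] EuclideanSpace ℝ (Fin 3))} (h : M ⊆ M') :
    reachGroup M ≤ reachGroup M' :=
  AddSubgroup.closure_mono fun _ ⟨F, hF, w, hw, hv⟩ => ⟨F, h hF, w, hw, hv⟩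

/-- The REACH SET of the grain `(A, t)` with frame set `M`: the affine lattice `A·Λ₀ + t` translated by the reach group. -/
def reachSet (A : EuclideanSpace ℝ (Fin 3) ≃ₗᵢ[ℝ] EuclideanSpace ℝ (Fin 3)) (t : EuclideanSpace ℝ (Fin 3))
    (M : Set (EuclideanSpace ℝ (Fin 3) ≃ₗᵢ[ℝ] EuclideanSpace ℝ (Fin 3))) : Set (EuclideanSpace ℝ (Fin 3)) :=
  {y | ∃ x ∈ fccStacking 1 (Real.sqrt (2 / 3)), ∃ v ∈ reachGroup M, y = A x + t + v}

/-- Lattice balls of the grain are in its reach set. -/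
theorem mem_reachSet_of_mem_lattice {A : EuclideanSpace ℝ (Fin 3) ≃ₗᵢ[ℝ] EuclideanSpace ℝ (Fin 3)}
    {t : EuclideanSpace ℝ (Fin 3)} {M : Set (EuclideanSpace ℝ (Fin 3) ≃ₗᵢ[ℝ] EuclideanSpace ℝ (Fin 3))}
    {y : EuclideanSpace ℝ (Fin 3)} (hy : y ∈ (fun q => A q + t) '' fccStacking 1 (Real.sqrt (2 / 3))) :
    y ∈ reachSet A t M := by
  obtain ⟨x, hx, rfl⟩ := hy
  exact ⟨x, hx, 0, (reachGroup M).zero_mem, by simp⟩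

/-- The reach set is stable under translation by the reach group. -/
theorem add_mem_reachSet {A : EuclideanSpace ℝ (Fin 3) ≃ₗᵢ[ℝ] EuclideanSpace ℝ (Fin 3)} {t : EuclideanSpace ℝ (Fin 3)}
    {M : Set (EuclideanSpace ℝ (Fin 3) ≃ₗᵢ[ℝ] EuclideanSpace ℝ (Fin 3))} {y v : EuclideanSpace ℝ (Fin 3)}
    (hy : y ∈ reachSet A t M) (hv : v ∈ reachGroup M) : y + v ∈ reachSet A t M := by
  obtain ⟨x, hx, v₀, hv₀, rfl⟩ := hy
  exact ⟨x, hx, v₀ + v, (reachGroup M).add_mem hv₀ hv, by abel⟩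

/-- The reach set is monotone in the frame set. -/
theorem reachSet_mono {A : EuclideanSpace ℝ (Fin 3) ≃ₗᵢ[ℝ] EuclideanSpace ℝ (Fin 3)} {t : EuclideanSpace ℝ (Fin 3)}
    {M M' : Set (EuclideanSpace ℝ (Fin 3) ≃ₗᵢ[ℝ] EuclideanSpace ℝ (Fin 3))} (h : M ⊆ M') :
    reachSet A t M ⊆ reachSet A t M' :=
  fun _ ⟨x, hx, v, hv, hy⟩ => ⟨x, hx, v, reachGroup_mono h hv, hy⟩

/-- **Disjoint reach sets, unfolded**: the two reach sets are disjoint iff the relative translation avoids the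
REGISTRY SET `{A₁x₁ − A₂x₂ + v₁ − v₂}` (`xᵢ ∈ Λ₀`, `vᵢ ∈ reachGroup Mᵢ`). -/
theorem reachSet_disjoint_iff {A₁ A₂ : EuclideanSpace ℝ (Fin 3) ≃ₗᵢ[ℝ] EuclideanSpace ℝ (Fin 3)}
    {t₁ t₂ : EuclideanSpace ℝ (Fin 3)} {M₁ M₂ : Set (EuclideanSpace ℝ (Fin 3) ≃ₗᵢ[ℝ] EuclideanSpace ℝ (Fin 3))} :
    (∀ y ∈ reachSet A₁ t₁ M₁, y ∉ reachSet A₂ t₂ M₂) ↔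
      ∀ x₁ ∈ fccStacking 1 (Real.sqrt (2 / 3)), ∀ x₂ ∈ fccStacking 1 (Real.sqrt (2 / 3)),
        ∀ v₁ ∈ reachGroup M₁, ∀ v₂ ∈ reachGroup M₂, t₂ - t₁ ≠ A₁ x₁ - A₂ x₂ + v₁ - v₂ := by
  constructor
  · intro h x₁ hx₁ x₂ hx₂ v₁ hv₁ v₂ hv₂ ht
    refine h (A₁ x₁ + t₁ + v₁) ⟨x₁, hx₁, v₁, hv₁, rfl⟩ ⟨x₂, hx₂, v₂, hv₂, ?_⟩
    have : t₁ = t₂ - (A₁ x₁ - A₂ x₂ + v₁ - v₂) := by rw [← ht]; abel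
    rw [this]; abel
  · rintro h y ⟨x₁, hx₁, v₁, hv₁, rfl⟩ ⟨x₂, hx₂, v₂, hv₂, hy⟩
    refine h x₁ hx₁ x₂ hx₂ v₁ hv₁ v₂ hv₂ ?_
    have : t₂ = A₁ x₁ + t₁ + v₁ - A₂ x₂ - v₂ := by rw [hy]; abel
    rw [this]; abel

/-! ### Every step moves by a slot vector of the new top frame -/

/-- **Step anatomy, positions.**  A successful step from `(y, stk)` lands at `y + e′.frame e′.dir`, `e′` the top entry
of the NEW stack (FULL: the old top; POP: the entry below; PUSH: the pushed twin entry). -/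
theorem walkStep_fst_eq_add_top {z y : EuclideanSpace ℝ (Fin 3)} {stk : List WalkEntry}
    {s' : EuclideanSpace ℝ (Fin 3) × List WalkEntry} (h : walkStep X z (y, stk) = some s') :
    ∃ e' rest', s'.2 = e' :: rest' ∧ s'.1 = y + e'.frame e'.dir := by
  cases stk with
  | nil => simp at h
  | cons e rest =>
    rcases walkStep_cases h with ⟨-, hs⟩ | ⟨n, -, ⟨e', rest', -, -, hs⟩ | ⟨-, hs⟩⟩
    · exact ⟨e, rest, by rw [hs], by rw [hs]⟩
    · exact ⟨e', rest', by rw [hs], by rw [hs]⟩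
    · rw [pushMove_eq] at hs
      exact ⟨_, _, by rw [hs], by rw [hs]⟩

/-- **Walk positions stay in the reach set.**  If every frame of every sound well-formed stack over the bottom `b` lies
in `M`, then a run started at a state over `b` whose position is in `reachSet A t M` stays in `reachSet A t M`. -/
theorem walkRun_fst_mem_reachSet (hX : ∀ p ∈ X, ∀ q ∈ X, p ≠ q → 1 ≤ dist p q)
    {s₀ : EuclideanSpace ℝ (Fin 3)} (hs₀ : s₀ ∈ fccSlots)
    (hcert : ExactOnly 0 (fccSlots.filter fun w => 0 < ⟪w, s₀⟫_ℝ))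
    {z : EuclideanSpace ℝ (Fin 3)} (hz : ‖z‖ = 1)
    {A : EuclideanSpace ℝ (Fin 3) ≃ₗᵢ[ℝ] EuclideanSpace ℝ (Fin 3)} {t : EuclideanSpace ℝ (Fin 3)}
    {M : Set (EuclideanSpace ℝ (Fin 3) ≃ₗᵢ[ℝ] EuclideanSpace ℝ (Fin 3))} {b : WalkEntry}
    (hM : ∀ stk : List WalkEntry, StackSound z stk → StackWF z stk → stk.getLast? = some b → ∀ e ∈ stk, e.frame ∈ M) :
    ∀ (k : ℕ) (s : EuclideanSpace ℝ (Fin 3) × List WalkEntry), WalkInv X z s → StackWF z s.2 →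
      s.2.getLast? = some b → s.1 ∈ reachSet A t M → (walkRun X z k s).1 ∈ reachSet A t M
  | 0, _, _, _, _, hs => hs
  | k + 1, s, hI, hW, hl, hs => by
    cases h : walkStep X z s with
    | none => rw [walkRun_succ_of_none X z k h]; exact hs
    | some s' =>
      rw [walkRun_succ_of_some X z k h]
      obtain ⟨hI', -, -⟩ := walkStep_walkInv hX hs₀ hcert hz hI h
      have hW' : StackWF z s'.2 := walkStep_stackWF hW h
      obtain ⟨-, -, e, rest, hstk, -⟩ := hI
      have hl' : s'.2.getLast? = some b := by
        rw [walkStep_getLast? (by rw [hstk]; exact List.cons_ne_nil e rest) h]; exact hl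
      obtain ⟨y, stk⟩ := s
      obtain ⟨e', rest', hstk', hy'⟩ := walkStep_fst_eq_add_top h
      refine walkRun_fst_mem_reachSet hX hs₀ hcert hz hM k s' hI' hW' hl' ?_
      rw [hy']
      have hS' := hI'.2.1
      rw [hstk'] at hS'
      exact add_mem_reachSet hs
        (frame_slot_mem_reachGroup (hM s'.2 hI'.2.1 hW' hl' e' (by rw [hstk']; exact List.mem_cons_self))
          (StackSound.top z hS').1)

/-- **A grain's walker never leaves its reach set** (the form the ledger uses): started at `p + A u` over the bottom
`⟨A, u, 0⟩` from a full lattice ball `p ∈ A·Λ₀ + t`, after any number of steps the position is in `reachSet A t M`. -/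
theorem walkEnd_mem_reachSet (hX : ∀ p ∈ X, ∀ q ∈ X, p ≠ q → 1 ≤ dist p q)
    {s₀ : EuclideanSpace ℝ (Fin 3)} (hs₀ : s₀ ∈ fccSlots)
    (hcert : ExactOnly 0 (fccSlots.filter fun w => 0 < ⟪w, s₀⟫_ℝ))
    {z : EuclideanSpace ℝ (Fin 3)} (hz : ‖z‖ = 1)
    (A : EuclideanSpace ℝ (Fin 3) ≃ₗᵢ[ℝ] EuclideanSpace ℝ (Fin 3)) (t : EuclideanSpace ℝ (Fin 3))
    {M : Set (EuclideanSpace ℝ (Fin 3) ≃ₗᵢ[ℝ] EuclideanSpace ℝ (Fin 3))} {u : EuclideanSpace ℝ (Fin 3)}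
    (hM : ∀ stk : List WalkEntry, StackSound z stk → StackWF z stk → stk.getLast? = some ⟨A, u, 0⟩ →
      ∀ e ∈ stk, e.frame ∈ M)
    {p : EuclideanSpace ℝ (Fin 3)} (hpΛ : p ∈ (fun q => A q + t) '' fccStacking 1 (Real.sqrt (2 / 3)))
    (hp : p ∈ X) (hfull : ∀ w ∈ fccSlots, p + A w ∈ X) (hu : u ∈ fccSlots) (hsteep : Real.sqrt 2 / 2 ≤ ⟪A u, z⟫_ℝ)
    (N : ℕ) : (walkRun X z N (p + A u, [⟨A, u, 0⟩])).1 ∈ reachSet A t M := by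
  have hI₀ : WalkInv X z (p + A u, [⟨A, u, 0⟩]) := walkInv_start A hp hfull hu hsteep
  have hA : A ∈ M := hM [⟨A, u, 0⟩] hI₀.2.1 (stackWF_start z A u) rfl ⟨A, u, 0⟩ (List.mem_singleton_self _)
  exact walkRun_fst_mem_reachSet hX hs₀ hcert hz hM N _ hI₀ (stackWF_start z A u) rfl
    (add_mem_reachSet (mem_reachSet_of_mem_lattice hpΛ) (frame_slot_mem_reachGroup hA hu))

end Summit.Ventures.Crystal3D.Theorems

end
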